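import Mathlib
import HarnessLib.Audit
import Summits.PneNP.PneNP.Theorems.PstarCrossData
import Summits.PneNP.PneNP.Theorems.PstarGateCasePNorHolders
import Summits.PneNP.PneNP.Theorems.PstarGateCasePUnitsTouch

/-!
# The blind free CROSS gate: the expansion BUDGET with the gate footprint, and the TOUCH lemma (O2 / E1; prover-1 g22)

FRONTIER range-avoidance ladder, rung F-N3 (`stmt-PneNP-19007`), cell `pnp-ideate`; restricted-model proof complexity — nothing here bears on `P` versus `NP`.

Cross data `B` (`PstarCrossData.CrossData I r B e_p e_q g₀`).  Boundary count on `X = J₀ ∪ {g₀}` (`#X ≤ r`): XOR slots of core outputs are inner (the core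
is XOR-closed); BOTH AND variables of the cross gate `g₀ = (p, q)` are chord privates, so `g₀` pays at most its two XOR inputs, `e_p` and `e_q` pay at most
one each (the mates `p', q'`), every other chord at most `2`, a tree edge at most `2` and at most `1` unless it is PRIVATE (both AND variables unread by
every other output of `X`).  `(r, 3/2)`-expansion then reads

* `cross_budget` — **`#(J₀ ∖ N) + 3 ≤ #N + 2 · #{private tree edges}`** (compare the one-gate budget `#(J₀ ∖ N) + 1 ≤ #N + 2·#Pv` of `PstarGateBudget`:
  the cross gate is two boundary variables more expensive, its second AND variable being a private too).  CORRECTION of the informal expansion remark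
  in the module docstring of `PstarCrossData` (which forgot the XOR inputs of `g₀` and claimed `+ 7`): the right constant is `+ 3`, and cross data with
  `#J₀ ≤ 5` are NOT excluded by counting alone.
* `cross_touch` — **TOUCH**: a private tree edge whose AND pair is read by neither constraint (not linearly, not through a monomial) contradicts
  (T3)/(M0) (overwrite its AND pair at the (M0) witness; `PstarGateCasePUnitsTouch.touch` on the data with the gate put back).
So every private tree edge is touched by a linear AND-read or a monomial of `R` or `w₂`, and there are at least `(#(J₀ ∖ N) + 3 − #N)/2` of them.
-/

set_option linter.dupNamespace false -- `Summit.PneNP.PneNP.…`: summit = sub-problem name (D-0017 single-conjunct layout)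

open Finset Literature.Computability.Complexity
open Summit.PneNP.PneNP.Theorems.PstarTyped (Typed)
open Summit.PneNP.PneNP.Theorems.PstarSALevel (varSet bdry BoundaryExpanding SimpleOverlap)
open Summit.PneNP.PneNP.Theorems.PstarCentreFree (vars_mem_varSet)
open Summit.PneNP.PneNP.Theorems.PstarGapPeeling (not_mem_varSet_of_private)
open Summit.PneNP.PneNP.Theorems.PstarXCore (xverts)
open Summit.PneNP.PneNP.Theorems.PstarCoreBound (XorClosed)
open Summit.PneNP.PneNP.Theorems.PstarChordBridgeTools (privs mem_privs vars_mem_privs)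
open Summit.PneNP.PneNP.Theorems.PstarChordBridge (BridgeData Solution)
open Summit.PneNP.PneNP.Theorems.PstarNorCoreTools (not_mem_bdry_of_two card_varSet_inter_bdry_le card_bdry_le_sum)
open Summit.PneNP.PneNP.Theorems.PstarGateCasePNorHolders (not_mem_bdry_of_closed card_three_slots)
open Summit.PneNP.PneNP.Theorems.PstarGateCasePUnitsTouch (touch)
open Summit.PneNP.PneNP.Theorems.PstarCrossData (CSolution CrossData)

namespace Summit.PneNP.PneNP.Theorems.PstarCrossBudget

variable {n m : ℕ}

/-- **The cross budget.**  See the module docstring. -/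
theorem cross_budget (I : LocalMap 4 n m) {r₀ : ℕ} (hB : BoundaryExpanding r₀ I) {B : BridgeData n m} {e_p e_q g₀ : Fin m}
    (hD : CrossData I r₀ B e_p e_q g₀) :
    ∃ Pv ⊆ B.J₀ \ B.N,
      (∀ j ∈ Pv, ∀ j' ∈ insert g₀ B.J₀, j' ≠ j → I.vars j 2 ∉ varSet I j' ∧ I.vars j 3 ∉ varSet I j') ∧
      (B.J₀ \ B.N).card + 3 ≤ B.N.card + 2 * Pv.card := by
  classical
  have hW := hD.wf
  have hXc := hD.closed
  have hpN : e_p ∈ B.N := hD.mem_p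
  have hqN : e_q ∈ B.N := hD.mem_q
  have hpJ : e_p ∈ B.J₀ := hW.hN hpN
  have hqJ : e_q ∈ B.J₀ := hW.hN hqN
  have hg₀J : g₀ ∉ B.J₀ := fun h => disjoint_left.1 hD.disj₁ (mem_insert_self g₀ B.G₁) h
  set F := B.J₀ \ B.N with hFdef
  have hFJ : F ⊆ B.J₀ := sdiff_subset
  set X : Finset (Fin m) := insert g₀ B.J₀ with hXdef
  set Pv := F.filter (fun j => ∀ j' ∈ X, j' ≠ j → I.vars j 2 ∉ varSet I j' ∧ I.vars j 3 ∉ varSet I j') with hPv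
  refine ⟨Pv, filter_subset _ _, fun j hj => (mem_filter.1 hj).2, ?_⟩
  have hJX : B.J₀ ⊆ X := subset_insert _ _
  have hg₀X : g₀ ∈ X := mem_insert_self _ _
  have hXr : X.card ≤ r₀ :=
    (card_le_card (insert_subset (mem_union_left _ (mem_union_right _ (mem_insert_self g₀ B.G₁)))
      (subset_union_left.trans subset_union_left))).trans hD.rad
  have hXcard : X.card = B.J₀.card + 1 := by rw [hXdef, card_insert_of_notMem hg₀J]
  have hp_g₀ : I.vars e_p 2 ∈ varSet I g₀ := hD.gate_vars.1 ▸ vars_mem_varSet I g₀ 2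
  have hq_g₀ : I.vars e_q 2 ∈ varSet I g₀ := hD.gate_vars.2 ▸ vars_mem_varSet I g₀ 3
  have hg₀_p : I.vars g₀ 2 ∈ varSet I e_p := by rw [hD.gate_vars.1]; exact vars_mem_varSet I e_p 2
  have hg₀_q : I.vars g₀ 3 ∈ varSet I e_q := by rw [hD.gate_vars.2]; exact vars_mem_varSet I e_q 2
  -- per-output budgets
  let q : Fin m → ℕ := fun k => if k = g₀ then 2 else if k ∈ (B.N.erase e_p).erase e_q then 2 else if k ∈ Pv then 2 else 1
  have htwo : ∀ k ∈ X, k ∈ B.J₀ → (varSet I k ∩ bdry I X).card ≤ 2 := by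
    intro k hk hkJ
    have h := card_varSet_inter_bdry_le I X k {0, 1} (fun s hs => by
      simp only [mem_insert, mem_singleton] at hs
      rcases hs with rfl | rfl
      · exact not_mem_bdry_of_closed I hXc hJX hkJ (by decide)
      · exact not_mem_bdry_of_closed I hXc hJX hkJ (by decide))
    have h2 : ({0, 1} : Finset (Fin 4)).card = 2 := by decide
    rw [h2] at h; exact h
  have hq : ∀ k ∈ X, (varSet I k ∩ bdry I X).card ≤ q k := by
    intro k hk
    by_cases hkg₀ : k = g₀
    · subst hkg₀
      simp only [q, if_true]
      have h := card_varSet_inter_bdry_le I X k {2, 3} (fun s hs => by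
        simp only [mem_insert, mem_singleton] at hs
        rcases hs with rfl | rfl
        · exact not_mem_bdry_of_two I hk (hJX hpJ) (fun h => hg₀J (h ▸ hpJ)) (vars_mem_varSet I k 2) hg₀_p
        · exact not_mem_bdry_of_two I hk (hJX hqJ) (fun h => hg₀J (h ▸ hqJ)) (vars_mem_varSet I k 3) hg₀_q)
      have h2 : ({2, 3} : Finset (Fin 4)).card = 2 := by decide
      rw [h2] at h; exact h
    have hkJ : k ∈ B.J₀ := by
      rw [hXdef, mem_insert] at hk
      rcases hk with h | h
      · exact absurd h hkg₀
      · exact h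
    by_cases hkN : k ∈ (B.N.erase e_p).erase e_q
    · simp only [q, if_neg hkg₀, if_pos hkN]
      exact htwo k hk hkJ
    by_cases hkP : k ∈ Pv
    · simp only [q, if_neg hkg₀, if_neg hkN, if_pos hkP]
      exact htwo k hk hkJ
    · simp only [q, if_neg hkg₀, if_neg hkN, if_neg hkP]
      -- `e_p`, `e_q`, or a non-private tree edge: one AND slot held elsewhere
      obtain ⟨s, hs2, k', hk', hne', hv⟩ : ∃ s : Fin 4, 2 ≤ s.val ∧ ∃ k' ∈ X, k' ≠ k ∧ I.vars k s ∈ varSet I k' := by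
        by_cases hkp : k = e_p
        · subst hkp
          exact ⟨2, by decide, g₀, hg₀X, fun h => hg₀J (h ▸ hpJ), hp_g₀⟩
        by_cases hkq : k = e_q
        · subst hkq
          exact ⟨2, by decide, g₀, hg₀X, fun h => hg₀J (h ▸ hqJ), hq_g₀⟩
        have hkF : k ∈ F := mem_sdiff.2 ⟨hkJ, fun hkN' => hkN (mem_erase.2 ⟨hkq, mem_erase.2 ⟨hkp, hkN'⟩⟩)⟩
        have hnp : ¬ ∀ j' ∈ X, j' ≠ k → I.vars k 2 ∉ varSet I j' ∧ I.vars k 3 ∉ varSet I j' :=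
          fun h => hkP (mem_filter.2 ⟨hkF, h⟩)
        push Not at hnp
        obtain ⟨j', hj'X, hj'k, hj'⟩ := hnp
        by_cases h2 : I.vars k 2 ∈ varSet I j'
        · exact ⟨2, by decide, j', hj'X, hj'k, h2⟩
        · exact ⟨3, by decide, j', hj'X, hj'k, hj' h2⟩
      have h := card_varSet_inter_bdry_le I X k {0, 1, s} (fun s' hs' => by
        simp only [mem_insert, mem_singleton] at hs'
        rcases hs' with rfl | rfl | rfl
        · exact not_mem_bdry_of_closed I hXc hJX hkJ (by decide)
        · exact not_mem_bdry_of_closed I hXc hJX hkJ (by decide)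
        · exact not_mem_bdry_of_two I hk hk' (Ne.symm hne') (vars_mem_varSet I k s') hv)
      rw [card_three_slots hs2] at h
      exact h
  have hbd := card_bdry_le_sum I X q hq
  -- evaluate the sum over `J₀ = N ⊔ F`
  have hqg₀ : q g₀ = 2 := by
    show (if g₀ = g₀ then 2 else if g₀ ∈ (B.N.erase e_p).erase e_q then 2 else if g₀ ∈ Pv then 2 else 1) = 2
    rw [if_pos rfl]
  have hJsplit : B.J₀ = B.N ∪ F := by rw [hFdef, union_sdiff_of_subset hW.hN]
  have hdisj : Disjoint B.N F := by rw [hFdef]; exact disjoint_sdiff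
  have hqpe : e_q ∈ B.N.erase e_p := mem_erase.2 ⟨hD.ne.symm, hqN⟩
  have hsumN : ∑ k ∈ B.N, q k = 2 + 2 * ((B.N.erase e_p).erase e_q).card := by
    rw [← add_sum_erase B.N q hpN, ← add_sum_erase _ q hqpe]
    have hpg₀ : e_p ≠ g₀ := fun h => hg₀J (h ▸ hpJ)
    have hqg₀ : e_q ≠ g₀ := fun h => hg₀J (h ▸ hqJ)
    have hpP : e_p ∉ Pv := fun h => (mem_sdiff.1 (mem_filter.1 h).1).2 hpN
    have hqP : e_q ∉ Pv := fun h => (mem_sdiff.1 (mem_filter.1 h).1).2 hqN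
    have hpN : e_p ∉ (B.N.erase e_p).erase e_q := fun h => (notMem_erase e_p B.N) (mem_of_mem_erase h)
    have hqe : q e_p = 1 := by
      show (if e_p = g₀ then 2 else if e_p ∈ (B.N.erase e_p).erase e_q then 2 else if e_p ∈ Pv then 2 else 1) = 1
      rw [if_neg hpg₀, if_neg hpN, if_neg hpP]
    have hqe' : q e_q = 1 := by
      show (if e_q = g₀ then 2 else if e_q ∈ (B.N.erase e_p).erase e_q then 2 else if e_q ∈ Pv then 2 else 1) = 1
      rw [if_neg hqg₀, if_neg (notMem_erase e_q _), if_neg hqP]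
    rw [hqe, hqe', ← add_assoc, mul_comm, card_eq_sum_ones, sum_mul]
    congr 1
    refine sum_congr rfl fun k hk => ?_
    have hkJ : k ∈ B.J₀ := hW.hN (mem_of_mem_erase (mem_of_mem_erase hk))
    have hkg₀ : k ≠ g₀ := fun h => hg₀J (h ▸ hkJ)
    show (if k = g₀ then 2 else if k ∈ (B.N.erase e_p).erase e_q then 2 else if k ∈ Pv then 2 else 1) = 1 * 2
    rw [if_neg hkg₀, if_pos hk, one_mul]
  have hsumF : ∑ k ∈ F, q k = F.card + Pv.card := by
    have hsplit := (sum_filter_add_sum_filter_not F (fun k => k ∈ Pv) q).symm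
    have hf1 : F.filter (fun k => k ∈ Pv) = Pv := by
      ext k
      simp only [mem_filter]
      exact ⟨fun h => h.2, fun h => ⟨(mem_filter.1 h).1, h⟩⟩
    rw [hsplit, hf1]
    have hFN' : ∀ k ∈ F, k ∉ (B.N.erase e_p).erase e_q := fun k hkF h =>
      (mem_sdiff.1 hkF).2 (mem_of_mem_erase (mem_of_mem_erase h))
    have h1 : ∑ k ∈ Pv, q k = 2 * Pv.card := by
      rw [mul_comm, card_eq_sum_ones, sum_mul]
      refine sum_congr rfl fun k hk => ?_
      have hkF := (mem_filter.1 hk).1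
      have hkg₀ : k ≠ g₀ := fun h => hg₀J (h ▸ hFJ hkF)
      show (if k = g₀ then 2 else if k ∈ (B.N.erase e_p).erase e_q then 2 else if k ∈ Pv then 2 else 1) = 1 * 2
      rw [if_neg hkg₀, if_neg (hFN' k hkF), if_pos hk, one_mul]
    have h2 : ∑ k ∈ F.filter (fun k => k ∉ Pv), q k = (F.filter (fun k => k ∉ Pv)).card := by
      rw [card_eq_sum_ones]
      refine sum_congr rfl fun k hk => ?_
      obtain ⟨hkF, hkP⟩ := mem_filter.1 hk
      have hkg₀ : k ≠ g₀ := fun h => hg₀J (h ▸ hFJ hkF)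
      show (if k = g₀ then 2 else if k ∈ (B.N.erase e_p).erase e_q then 2 else if k ∈ Pv then 2 else 1) = 1
      rw [if_neg hkg₀, if_neg (hFN' k hkF), if_neg hkP]
    rw [h1, h2]
    have hc := card_filter_add_card_filter_not (s := F) (fun k => k ∈ Pv)
    rw [hf1] at hc
    omega
  have hsumX : ∑ k ∈ X, q k = 2 + ((2 + 2 * ((B.N.erase e_p).erase e_q).card) + (F.card + Pv.card)) := by
    rw [hXdef, sum_insert hg₀J, hqg₀, hJsplit, sum_union hdisj, hsumN, hsumF]
  have hexp := hB X hXr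
  rw [hXcard] at hexp
  rw [hsumX, card_erase_of_mem hqpe, card_erase_of_mem hpN] at hbd
  have hJcard : B.J₀.card = B.N.card + F.card := by rw [hJsplit, card_union_of_disjoint hdisj]
  have hN2 : 2 ≤ B.N.card := by
    have : ({e_p, e_q} : Finset (Fin m)) ⊆ B.N := insert_subset hpN (singleton_subset_iff.2 hqN)
    have h2 : ({e_p, e_q} : Finset (Fin m)).card = 2 := card_pair hD.ne
    exact h2 ▸ card_le_card this
  omega

/-- **TOUCH for cross data.**  A tree edge `π` private within `J₀ ∪ {g₀}` whose AND pair is read by neither constraint (not linearly, not through a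
monomial) is impossible: overwrite its AND pair at the (M0) witness of `π`. -/
theorem cross_touch (I : LocalMap 4 n m) (hI : I.IsPure xorAndPred) {r₀ : ℕ} {B : BridgeData n m} {e_p e_q g₀ : Fin m}
    (hD : CrossData I r₀ B e_p e_q g₀) {π : Fin m} (hπ : π ∈ B.J₀ \ B.N)
    (hpriv : ∀ j ∈ B.J₀, j ≠ π → I.vars π 2 ∉ varSet I j ∧ I.vars π 3 ∉ varSet I j)
    (hC₁ : I.vars π 2 ∉ B.C₁ ∧ I.vars π 3 ∉ B.C₁) (hC₂ : I.vars π 2 ∉ B.C₂ ∧ I.vars π 3 ∉ B.C₂)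
    (hG₁ : ∀ g ∈ B.G₁, I.vars g 2 ≠ I.vars π 2 ∧ I.vars g 3 ≠ I.vars π 2 ∧ I.vars g 2 ≠ I.vars π 3 ∧ I.vars g 3 ≠ I.vars π 3)
    (hG₂ : ∀ g ∈ B.G₂, I.vars g 2 ≠ I.vars π 2 ∧ I.vars g 3 ≠ I.vars π 2 ∧ I.vars g 2 ≠ I.vars π 3 ∧ I.vars g 3 ≠ I.vars π 3) : False := by
  have hπJ : π ∈ B.J₀ := (mem_sdiff.1 hπ).1
  -- the gate does not touch `π` either: its AND variables are chord privates
  have hg₀π : I.vars g₀ 2 ≠ I.vars π 2 ∧ I.vars g₀ 3 ≠ I.vars π 2 ∧ I.vars g₀ 2 ≠ I.vars π 3 ∧ I.vars g₀ 3 ≠ I.vars π 3 := by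
    have hπp : π ≠ e_p := fun h => (mem_sdiff.1 hπ).2 (h ▸ hD.mem_p)
    have hπq : π ≠ e_q := fun h => (mem_sdiff.1 hπ).2 (h ▸ hD.mem_q)
    have hp2 := (hpriv e_p (hD.wf.hN hD.mem_p) hπp.symm)
    have hq2 := (hpriv e_q (hD.wf.hN hD.mem_q) hπq.symm)
    rw [hD.gate_vars.1, hD.gate_vars.2]
    exact ⟨fun h => hp2.1 (h ▸ vars_mem_varSet I e_p 2), fun h => hq2.1 (h ▸ vars_mem_varSet I e_q 2),
      fun h => hp2.2 (h ▸ vars_mem_varSet I e_p 2), fun h => hq2.2 (h ▸ vars_mem_varSet I e_q 2)⟩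
  let B' : BridgeData n m := { B with G₁ := insert g₀ B.G₁ }
  refine touch I hI (B := B') hD.T3 (hD.M0 π hπJ) hpriv hC₁ hC₂ (fun g hg => ?_) hG₂
  rcases mem_insert.1 hg with h | h
  · rw [h]; exact hg₀π
  · exact hG₁ g h

end Summit.PneNP.PneNP.Theorems.PstarCrossBudget
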